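import Summits.QuantumFields.YangMills.Theses.SlackWindow

/-!
# Route SlackWindow — the item `Assembly` (stmt-QuantumFields-23099), proved

`SlackCeilings → FloorsCond → SlackCalibration → HypercubicOSDataFromInfiniteVolume`: modus ponens, since
`FloorsCond` is `OnsetCalibration.OnsetFloors` by definition and `SlackCalibration` is
`SlackCeilings → OnsetFloors → leaf`.  Pure logic; the cruxes `SlackCeilings` (stmt-23097), `FloorsCond`
(stmt-25892) and the support `SlackCalibration` (stmt-23098) remain hypotheses of the route — no summit, rung
or crux is proved here. [folklore]
-/

namespace Summit.QuantumFields.YangMills.Theorems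

open Summit.QuantumFields.YangMills.Theses.SlackWindow

/-- The route's `Assembly` item holds: `hC hK hF`. [folklore] -/
theorem slackWindow_assembly_proof : Summit.QuantumFields.YangMills.Theses.SlackWindow.Assembly :=
  fun hK hF hC => hC hK hF

end Summit.QuantumFields.YangMills.Theorems
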